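import Summits.MatrixMultiplication.MatrixMultiplication.Theorems.AbelianSTPPCensusShapeCertVQKGDefs
import Summits.MatrixMultiplication.MatrixMultiplication.Theorems.AbelianSTPPCensusShapeCertVQKSemantics
import Summits.MatrixMultiplication.MatrixMultiplication.Theorems.AbelianSTPPCensusShapeCertVPFinal
import Summits.MatrixMultiplication.MatrixMultiplication.Theorems.AbelianSTPPCensusU11GPrime

/-!
# Abelian STPP census — soundness of `ShapeCertVQ.checkQKG`, part 1: rule U11 in credit form under a general budget constant, and the node kill

Cell mm-stpp, rung F-M1; census-silent kernel ENABLER for the tranche-2 device band on `T_E` (orders `≥ 477`), in support of the closed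
crux item stmt-MatrixMultiplication-19191; seat mm-stpp-vp-p2 (gen 9).  Semantic vocabulary and the new facts behind the one addition of
`…ShapeCertVQKGDefs` to vp-p2 g3's search `checkQK` (everything else is g1/g2/g3's `AboveQ` / `AdmK` theory, reused by name):
* `AdmGB bud t0 M G` — a U11-type rule in CREDIT FORM on a multiset of triples with the budget constant `bud t` and guard `t0 ≤ t`
  (`ShapeCertVP.AdmG` is the trio's instance `+ 1 ≤ … + 2t²`, `t ≥ 3`: `admGB_of_admG`); `AdmGB.mono` — it passes to sub-multisets (the
  credits are dominated by the weights, `ShapeCertVP.crT_le`); `AdmGW := AdmGB TAStatQ.gwC 2` — **rule U11-G′ in credit form**;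
* `creditGW_of_formB`, **`admGW_GM`** — the three letter forms of theory g13's `U11GPrime` (floor `t(P₁+P₂) − ⌊(4t²−2t)/3⌋` vs the ceiling
  `UB(t)`, `AbelianSTPPCensusU11GPrime.lean`) give `AdmGW M` on the shape multiset `ShapeCert.GM a b c` of a `SieveAdmissible` list (packing
  `P₃ ≤ M`; verbatim the argument of `ShapeCertVP.admG_GM`, with `ShapeCertVP.ubB_credit`);
* `admRTB_spec`, `not_admGB_of_killAtB / _killFormB / _killGB`, **`AboveQ.false_of_killGB`**, `AboveQ.false_of_killGW`,
  **`AboveQ.false_of_killEKG`** — the node kill of `checkQKG` is sound: a killed prefix has no family above it satisfying `AdmK` and `AdmGW`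
  (as `ShapeCertVQ.not_admG_of_killVQ` for `killV`);
* `GoalKG` — the goal of the search induction (`GoalK` with `AdmGW M G` as one more standing hypothesis).
WHAT THIS IS NOT: no statement about STPP families or `ω` by itself; no census number; no new rule (U11-G′ = theory g13's `u11GPrimeSound`).
-/

set_option linter.dupNamespace false -- `MatrixMultiplication.MatrixMultiplication` (summit = problem, D-0017)
set_option autoImplicit false

namespace Summit.MatrixMultiplication.MatrixMultiplication.Theorems.ShapeCertVQ

open ShapeCert ShapeCertVP STPPThreeRoomEnergy Multiset

/-! ### Rule U11 in credit form under a general budget constant -/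

/-- **A U11-type rule in credit form on a multiset of triples at order `M`, budget constant `bud`, guard `t0`**: for every letter form `r`
and every admissible `t ≥ t0` (`t ≤ P₁`, `t ≤ P₂`, `t ≤ L_r(t)`), `t·Σ(ab+bc+ca) ≤ t·M + bud t + Σ cr_t` (`cr_t` = `ShapeCertVP.crT`).
The trio's `ShapeCertVP.AdmG` is `bud t = 2t² − 1, t0 = 3`; rule U11-G′ is `bud = TAStatQ.gwC, t0 = 2` (`AdmGW`). [original] -/
def AdmGB (bud : ℕ → ℕ) (t0 M : ℕ) (G : Multiset (ℕ × ℕ × ℕ)) : Prop :=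
  ∀ r t : ℕ, t0 ≤ t → t ≤ (G.map (p1T r)).sum → t ≤ (G.map (p2T r)).sum → t ≤ (G.map (fibT r t)).sum →
    t * (G.map uu).sum ≤ t * M + bud t + (G.map (crT r t)).sum

/-- **Rule U11-G′ in credit form** on a multiset of triples: `AdmGB` at `bud = TAStatQ.gwC` (`⌊(4t² − 2t)/3⌋`), `t0 = 2`. [original] -/
def AdmGW (M : ℕ) (G : Multiset (ℕ × ℕ × ℕ)) : Prop := AdmGB TAStatQ.gwC 2 M G

section admGB
variable {M : ℕ}

/-- The trio's credit form `ShapeCertVP.AdmG` is the instance `bud t = 2t² − 1`, `t0 = 3`. [bookkeeping] -/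
theorem admGB_of_admG {G : Multiset (ℕ × ℕ × ℕ)} (h : AdmG M G) : AdmGB (fun t => 2 * (t * t) - 1) 3 M G := by
  intro r t h3 hp1 hp2 hfib
  have key := h r t h3 hp1 hp2 hfib
  have h9 : 9 ≤ t * t := Nat.mul_le_mul h3 h3
  dsimp only
  omega

/-- **Heredity**: the credit form passes to sub-multisets (the credit of a member is at most `t` times its weight, `ShapeCertVP.crT_le`).
[original] -/
theorem AdmGB.mono {bud : ℕ → ℕ} {t0 : ℕ} {F G : Multiset (ℕ × ℕ × ℕ)} (h : AdmGB bud t0 M G) (hF : F ≤ G) : AdmGB bud t0 M F := by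
  intro r t ht hp1 hp2 hfib
  have hG := h r t ht ((hp1.trans (sum_map_le_of_le hF _))) (hp2.trans (sum_map_le_of_le hF _))
    (hfib.trans (sum_map_le_of_le hF _))
  rw [sum_map_split hF uu, sum_map_split hF (crT r t)] at hG
  have hcr : ((G - F).map (crT r t)).sum ≤ t * ((G - F).map uu).sum := by
    rw [← Multiset.sum_map_mul_left]
    exact Multiset.sum_map_le_sum_map _ _ fun x _ => crT_le r t x
  have e : t * ((F.map uu).sum + ((G - F).map uu).sum) = t * (F.map uu).sum + t * ((G - F).map uu).sum := by ring
  omega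

/-- Heredity of `AdmGW`. [bookkeeping] -/
theorem AdmGW.mono {F G : Multiset (ℕ × ℕ × ℕ)} (h : AdmGW M G) (hF : F ≤ G) : AdmGW M F := AdmGB.mono h hF

end admGB

section credit
/-! ### Rule U11-G′ in credit form from theory's form B -/

variable {N : ℕ}

/-- **form B of U11-G′ in credit form**: `t·(P_AB + P_BC + P_CA) ≤ t·M + ⌊(4t²−2t)/3⌋ + Σ cr_t` at every admissible `t ≥ 2` (with `P_CA ≤ M`;
the ceiling in credit form is `ShapeCertVP.ubB_credit`). [original] -/
theorem creditGW_of_formB {M : ℕ} {a b c : Fin N → ℕ} (hP : pCA a b c ≤ M) (h : U11GPrimeFormB M a b c)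
    {t : ℕ} (h2 : 2 ≤ t) (h1 : t ≤ pAB a b c) (h1' : t ≤ pBC a b c) (hl : t ≤ lB a b c t) :
    t * (pAB a b c + pBC a b c + pCA a b c) ≤
      t * M + TAStatQ.gwC t + ∑ i, (if b i < t then a i * b i * c i else t * (c i * a i)) := by
  have hf := h t h2 h1 h1' hl
  have hc := ubB_credit M a b c t hP
  have e : t * (pAB a b c + pBC a b c + pCA a b c) = t * (pAB a b c + pBC a b c) + t * pCA a b c := by ring
  unfold TAStatQ.gwC
  omega

/-- **rule U11-G′ in credit form for the shape multiset of a `SieveAdmissible ∧ U11GPrime` list** (`AdmGW M (GM a b c)`; the three letter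
forms as in `ShapeCertVP.admG_GM`). [original] -/
theorem admGW_GM {M : ℕ} (a b c : Fin N → ℕ) (hS : SieveAdmissible M a b c) (hG : U11GPrime M a b c) :
    AdmGW M (GM a b c) := by
  obtain ⟨hB, hA, hC⟩ := hG
  have hU2 := hS.2.2.1
  have pab_le : pAB a b c ≤ M := hU2.1
  have pbc_le : pBC a b c ≤ M := hU2.2.1
  have pca_le : pCA a b c ≤ M := hU2.2.2
  intro r t h3 hp1 hp2 hfib
  simp only [sum_GM] at hp1 hp2 hfib ⊢
  match r with
  | 0 =>
    -- form B: letters (a, b, c)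
    have := creditGW_of_formB pca_le hB h3 hp1 hp2 hfib
    simpa [uu, pab, pbc, pca, pAB, pBC, pCA, shp, crT, midT, xzT, vol, Finset.sum_add_distrib, mul_add] using this
  | 1 =>
    -- form A: letters (c, a, b)
    have hP : pCA c a b ≤ M := by unfold pCA; unfold pBC at pbc_le; exact pbc_le
    have := creditGW_of_formB hP hA h3 (by simpa [pAB, p1T, shp, pca] using hp1) (by simpa [pBC, p2T, shp, pab] using hp2)
      (by simpa [lB, fibT, midT, mnxzT, shp] using hfib)
    simpa [uu, pab, pbc, pca, pAB, pBC, pCA, shp, crT, midT, xzT, vol, Finset.sum_add_distrib, mul_add, mul_comm, mul_left_comm,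
      add_comm, add_left_comm, add_assoc] using this
  | r + 2 =>
    -- form C: letters (b, c, a)
    have hP : pCA b c a ≤ M := by unfold pCA; unfold pAB at pab_le; exact pab_le
    have := creditGW_of_formB hP hC h3 (by simpa [pAB, p1T, shp, pbc] using hp1) (by simpa [pBC, p2T, shp, pca] using hp2)
      (by simpa [lB, fibT, midT, mnxzT, shp] using hfib)
    simpa [uu, pab, pbc, pca, pAB, pBC, pCA, shp, crT, midT, xzT, vol, Finset.sum_add_distrib, mul_add, mul_comm, mul_left_comm,
      add_comm, add_left_comm] using this

end credit

section kill
/-! ### The U11-type node kill is sound -/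

variable {M : ℕ} {G : Multiset (ℕ × ℕ × ℕ)} {fam : List Sh}

/-- what `admRTB` certifies for a well-formed prefix [bookkeeping] -/
theorem admRTB_spec (hw : WfQ M fam) {t0 r t : ℕ} (h : admRTB t0 r t (aggOf M fam) fam = true) :
    t0 ≤ t ∧ t ≤ ((famT fam).map (p1T r)).sum ∧ t ≤ ((famT fam).map (p2T r)).sum ∧
      t ≤ ((famT fam).map (fibT r t)).sum := by
  unfold admRTB at h
  simp only [Bool.and_eq_true, decide_eq_true_eq] at h
  rw [P1Of_eqQ hw, P2Of_eqQ hw, fibL_eqQ hw] at h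
  exact ⟨h.1.1.1, h.1.1.2, h.1.2, h.2⟩

/-- **the kill is sound**: a kill at `(r, t)` refutes the credit form for the prefix [original] -/
theorem not_admGB_of_killAtB {bud : ℕ → ℕ} {t0 r t : ℕ} (hw : WfQ M fam) (h : killAtB bud t0 M r t (aggOf M fam) fam = true) :
    ¬ AdmGB bud t0 M (famT fam) := by
  intro hA
  unfold killAtB at h
  rw [Bool.and_eq_true, decide_eq_true_eq] at h
  obtain ⟨h0, hp1, hp2, hfib⟩ := admRTB_spec hw h.1
  have := hA r t h0 hp1 hp2 hfib
  rw [crS_eqQ hw, uuA_aggOfQ hw] at h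
  omega

/-- the kill test of a form refutes the credit form for the prefix [bookkeeping] -/
theorem not_admGB_of_killFormB {bud : ℕ → ℕ} {t0 : ℕ} {vtx : ℕ → ℕ} {r : ℕ} (hw : WfQ M fam)
    (h : killFormB bud t0 vtx M r (aggOf M fam) fam = true) : ¬ AdmGB bud t0 M (famT fam) := by
  unfold killFormB at h
  simp only [seqN_eq, Bool.or_eq_true] at h
  rcases h with ((h | h) | h) | h <;> exact not_admGB_of_killAtB hw h

/-- the node kill refutes the credit form for the prefix [bookkeeping] -/
theorem not_admGB_of_killGB {bud : ℕ → ℕ} {t0 : ℕ} {vtx : ℕ → ℕ} (hw : WfQ M fam)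
    (h : killGB bud t0 vtx M (aggOf M fam) fam = true) : ¬ AdmGB bud t0 M (famT fam) := by
  unfold killGB at h
  simp only [seqN_eq, Bool.and_eq_true, Bool.or_eq_true] at h
  rcases h.2 with (h' | h') | h' <;> exact not_admGB_of_killFormB hw h'

/-- **the U11-type node kill is sound**: a killed prefix has no family above it satisfying the credit form (heredity `AdmGB.mono`).
[original] -/
theorem AboveQ.false_of_killGB {bud : ℕ → ℕ} {t0 : ℕ} {vtx : ℕ → ℕ} (h : AboveQ M G fam) (hB : AdmGB bud t0 M G)
    (hk : killGB bud t0 vtx M (aggOf M fam) fam = true) : False :=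
  not_admGB_of_killGB h.wf hk (hB.mono h.le)

/-- **the U11-G′ node kill is sound** [original] -/
theorem AboveQ.false_of_killGW (h : AboveQ M G fam) (hW : AdmGW M G) (hk : killGW M (aggOf M fam) fam = true) : False :=
  h.false_of_killGB hW hk

/-- **the node kill of `checkQKG` is sound** (E3⁺/E3K: g3's `AboveQ.false_of_killEK`; U11-G′: `AboveQ.false_of_killGW`) [original] -/
theorem AboveQ.false_of_killEKG (h : AboveQ M G fam) (hK : AdmK M G) (hW : AdmGW M G)
    (hk : killEKG (divsQ M) M (aggOf M fam) fam = true) : False := by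
  unfold killEKG at hk
  rw [Bool.or_eq_true] at hk
  rcases hk with hk | hk
  · exact h.false_of_killEK hK hk
  · exact h.false_of_killGW hW hk

end kill

/-! ### The goal of the search induction -/

/-- What the search `dfsKG` below the prefix `fam` with remaining candidate list `R` guarantees: no vQKG-admissible family above the
prefix (vQ-admissible — `AboveQ` —, `AdmK` and `AdmGW`) beats, provided every tail member is listed in `R` or has ratio level `≤ loLev`.
[bookkeeping] -/
def GoalKG (M : ℕ) (fam R : List Sh) : Prop :=
  ∀ G : Multiset (ℕ × ℕ × ℕ), AboveQ M G fam → AdmK M G → AdmGW M G → M * D < gsumQ G →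
    (∀ x ∈ G - famT fam, levTQ x ≤ loLev ∨ shQ M x ∈ R) → False

end Summit.MatrixMultiplication.MatrixMultiplication.Theorems.ShapeCertVQ
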